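import Summits.Parity.GeneralizedHardyLittlewood.Theorems.PrimeLevelFamEdgeMomentsBeyondDiagonalDiagRemTwoTwoDeltaSub
import Summits.Parity.GeneralizedHardyLittlewood.Theorems.PrimeLevelFamEdgeMomentsBeyondDiagonalDiagRemTwoTwoBoseZero
import Summits.Parity.GeneralizedHardyLittlewood.Theorems.PrimeLevelFamEdgeMomentsBeyondDiagonalDiagRemP2TailHolds
import Summits.Parity.GeneralizedHardyLittlewood.Theorems.PrimeLevelFamEdgeMomentsBeyondDiagonalDiagRemInner
import HarnessLib

/-!
# Route `PrimeLevelFamEdge`, crux K_A `MomentsBeyondDiagonal` (stmt-Parity-20007), line «petersson_layers» v4, stub `stub_diag`: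
# **THE BOTH-SIDED MONOMIAL OF THE ORDER-`(2,2)` REMAINDER: `Σ a_nP₂ ⊗ a_nP₂ · ℓ⁺ⁱℓ⁺ʲ · r₀₀` has the log saving** (brick B1 of (R₂₂))

The one obstruction of order `(2,2)` identified in `Cruxes/MomentsBeyondDiagonal/Lines/petersson_layers_stub_diag_g12_R02_R22.md`:
both Selberg variables carry the decoration `P₂`, whose partial sums do NOT tend to zero. Assembly of
`…DiagRemTwoTwoDeltaSub.abs_doubleSum_delta_sub_le` (δ-subtraction) with `…DiagRemP2TailHolds.abs_sum_copTauW_primeSq_sub_le`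
((P2TAIL): `Σ_{k≤y}a_n(k)P₂(k) = c_n + O(D(n)(1+log y)⁻¹²)`), `…DiagRemTwoTwoBoseZero.abs_rem00_twoSeq_and_pointwise` (`r₀₀`:
two-sequence estimate + pointwise bounds, one `E₀₀`) and the trivial column bounds of `…DiagRemInner`.

* `abs_bothsided_primeSq_rem00_le` — **`∃ E₀₀ C₀ C_P ≥ 0`: (i) the two-sequence estimate for `r₀₀` (re-exported, same `E₀₀`);
  (ii) for all `n ≥ 1`, `Y ≥ 1`, `α > 0`, `i, j ≥ 1`, `K₁` with `2αK₁Y ≤ 1`: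
  `|Σ_{k₁,k₂≤Y} a_n(k₁)P₂(k₁)a_n(k₂)P₂(k₂)ℓ⁺(k₁)ⁱℓ⁺(k₂)ʲ r₀₀(αk₁k₂)| ≤ log^{i+j}Y·C₀W²(7√(2αK₁Y) + 37(1+|log 2αY²|)⁶/(1+log K₁)¹²)`,
  `W = (1+log Y)⁴ + C_P·D(n)`** — the same two savings as every one-sided monomial.

Def-free; theorems only. Helper `--supports stmt-Parity-20007`; closes nothing (bricks B3–B5 of (R₂₂) remain); K_A, K_B and the
Parity summit are NOT proved; nothing about Landau–Siegel zeros.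

## References
* E. Kowalski, P. Michel, J. VanderKam, J. reine angew. Math. 526 (2000), Prop. 5.1 p. 18.
  [cite: KowalskiMichelVanderKam2000, Prop. 5.1 — derivation (both-sided decorated remainder monomial, order (2,2))]
-/

noncomputable section

open Real Finset

namespace Summit.Parity.GeneralizedHardyLittlewood.Theorems.MomentsBeyondDiagonal.DiagCorner

open Summit.Parity.GeneralizedHardyLittlewood.Theorems.BeyondDiagonalBeatsQuarter.KernelFormXSq
  (copTauW divWeight divWeight_nonneg)
open Summit.Parity.GeneralizedHardyLittlewood.Theorems.BeyondDiagonalBeatsQuarter.Corner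

set_option maxHeartbeats 1600000 in
/-- **The both-sided monomial `a_nP₂ ⊗ a_nP₂ · r₀₀` has the log saving** (see the module docstring).
[cite: KowalskiMichelVanderKam2000, Prop. 5.1 — derivation (both-sided decorated remainder monomial, order (2,2))] -/
theorem abs_bothsided_primeSq_rem00_le : ∃ E₀₀ C₀ C_P : ℝ, 0 ≤ C₀ ∧ 0 ≤ C_P ∧
    (∀ (a₁ a₂ : ℕ → ℝ) (Y α B η : ℝ) (K₁ i j : ℕ), 1 ≤ Y → 0 < α → 1 ≤ i → 1 ≤ j →
      (∀ e : ℕ, e ≤ ⌊Y⌋₊ → |∑ k ∈ Icc 1 e, a₂ k| ≤ B) → (∀ e : ℕ, K₁ ≤ e → |∑ k ∈ Icc 1 e, a₁ k| ≤ η) →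
      2 * α * K₁ * Y ≤ 1 →
    |∑ k₁ ∈ Icc 1 ⌊Y⌋₊, ∑ k₂ ∈ Icc 1 ⌊Y⌋₊,
        a₁ k₁ * a₂ k₂ * ellp Y k₁ ^ i * ellp Y k₂ ^ j *
          ((∫ u₁ in Set.Ioi (0 : ℝ), ∫ u₂ in Set.Ioi ((α * k₁ * k₂) / u₁),
              Real.exp (-(u₁ + u₂)) / (1 - Real.exp (-(u₁ + u₂))) ^ 2) -
            (Real.log (1 / (α * k₁ * k₂)) / 2 + E₀₀))| ≤
      (∑ k ∈ Icc 1 ⌊Y⌋₊, |a₁ k| * ellp Y k ^ i) * (B * (Real.log Y ^ j * (3 * C₀ * Real.sqrt (2 * α * K₁ * Y)))) +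
        (∑ k ∈ Icc 1 ⌊Y⌋₊, |a₂ k| * ellp Y k ^ j) *
          ((2 * η) * (Real.log Y ^ i * (9 * C₀ * (1 + |Real.log (2 * α * Y ^ 2)|) ^ 6)))) ∧
    (∀ n : ℕ, n ≠ 0 → ∀ (Y α : ℝ) (K₁ i j : ℕ), 1 ≤ Y → 0 < α → 1 ≤ i → 1 ≤ j → 2 * α * K₁ * Y ≤ 1 →
    |∑ k₁ ∈ Icc 1 ⌊Y⌋₊, ∑ k₂ ∈ Icc 1 ⌊Y⌋₊,
        (copTauW n k₁ * ∑ p ∈ k₁.primeFactors, Real.log p ^ 2) *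
          (copTauW n k₂ * ∑ p ∈ k₂.primeFactors, Real.log p ^ 2) * ellp Y k₁ ^ i * ellp Y k₂ ^ j *
          ((∫ u₁ in Set.Ioi (0 : ℝ), ∫ u₂ in Set.Ioi ((α * k₁ * k₂) / u₁),
              Real.exp (-(u₁ + u₂)) / (1 - Real.exp (-(u₁ + u₂))) ^ 2) -
            (Real.log (1 / (α * k₁ * k₂)) / 2 + E₀₀))| ≤
      Real.log Y ^ (i + j) * (C₀ * ((1 + Real.log Y) ^ 4 + C_P * divWeight n) ^ 2 *
        (7 * Real.sqrt (2 * α * K₁ * Y) + 37 * (1 + |Real.log (2 * α * Y ^ 2)|) ^ 6 / (1 + Real.log K₁) ^ 12))) := by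
  obtain ⟨E₀₀, C₀, hC₀, hR2, hRs, hRt⟩ := abs_rem00_twoSeq_and_pointwise
  obtain ⟨C_P, hC_P, hP⟩ := abs_sum_copTauW_primeSq_sub_le
  refine ⟨E₀₀, C₀, C_P, hC₀, hC_P, hR2, fun n hn Y α K₁ i j hY hα hi hj hY₁ ↦ ?_⟩
  obtain ⟨c, hc, hcy⟩ := hP n hn
  set D : ℝ := divWeight n with hDdef
  have hD0 : 0 ≤ D := divWeight_nonneg n
  have hY0 : 0 < Y := by linarith
  have hLY : 0 ≤ Real.log Y := Real.log_nonneg hY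
  set L4 : ℝ := (1 + Real.log Y) ^ 4 with hL4
  have hL41 : 1 ≤ L4 := one_le_pow₀ (by linarith)
  set W : ℝ := L4 + C_P * D with hW
  have hW0 : 0 ≤ W := by positivity
  set x : ℝ := 1 + |Real.log (2 * α * Y ^ 2)| with hx
  have hx1 : 1 ≤ x := by rw [hx]; linarith [abs_nonneg (Real.log (2 * α * Y ^ 2))]
  set T : ℝ := C_P * D / (1 + Real.log K₁) ^ 12 with hT
  have hK0 : 0 ≤ Real.log (K₁ : ℝ) := Real.log_natCast_nonneg K₁
  have hT0 : 0 ≤ T := by positivity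
  have hTle : T ≤ C_P * D := div_le_self (by positivity) (one_le_pow₀ (by linarith))
  set sq : ℝ := Real.sqrt (2 * α * K₁ * Y) with hsq
  have hsq0 : 0 ≤ sq := Real.sqrt_nonneg _
  -- the sequence `b = a_n·P₂` and its data
  set b : ℕ → ℝ := fun k ↦ copTauW n k * ∑ p ∈ k.primeFactors, Real.log p ^ 2 with hb
  have hbt : ∀ e : ℕ, K₁ ≤ e → |∑ k ∈ Icc 1 e, (b k - if k = 1 then c else 0)| ≤ T := by
    intro e he
    rcases Nat.eq_zero_or_pos e with rfl | he0
    · simp only [show Icc (1 : ℕ) 0 = ∅ from Finset.Icc_eq_empty (by norm_num), Finset.sum_empty, abs_zero]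
      exact hT0
    · have h1e : 1 ∈ Icc 1 e := Finset.mem_Icc.2 ⟨le_rfl, he0⟩
      have hsum : ∑ k ∈ Icc 1 e, (b k - if k = 1 then c else 0) = (∑ k ∈ Icc 1 e, b k) - c := by
        rw [Finset.sum_sub_distrib, Finset.sum_ite_eq' (Icc 1 e) 1 (fun _ ↦ c), if_pos h1e]
      rw [hsum]
      have h := hcy (e : ℝ) (by exact_mod_cast he0)
      rw [Nat.floor_natCast] at h
      refine h.trans ?_
      rw [hT]
      apply div_le_div_of_nonneg_left (by positivity) (by positivity)
      have hle : Real.log (K₁ : ℝ) ≤ Real.log (e : ℝ) := by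
        rcases Nat.eq_zero_or_pos K₁ with rfl | hK
        · simp only [Nat.cast_zero, Real.log_zero]; exact Real.log_natCast_nonneg e
        · exact Real.log_le_log (by exact_mod_cast hK) (by exact_mod_cast he)
      exact pow_le_pow_left₀ (by positivity) (by linarith) 12
  have hbcol : ∀ e : ℕ, e ≤ ⌊Y⌋₊ → |∑ k ∈ Icc 1 e, b k| ≤ L4 := fun e he ↦ abs_sum_copTauW_primeSq_le n hY he
  -- the abstract δ-subtraction
  have hmain := abs_doubleSum_delta_sub_le (R := fun y ↦ (∫ u₁ in Set.Ioi (0 : ℝ), ∫ u₂ in Set.Ioi (y / u₁),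
      Real.exp (-(u₁ + u₂)) / (1 - Real.exp (-(u₁ + u₂))) ^ 2) - (Real.log (1 / y) / 2 + E₀₀))
    hR2 b c T L4 hY hα hi hj hY₁ hbt hbcol
  refine hmain.trans ?_
  -- the absolute sums
  have hSb : ∀ m : ℕ, ∑ k ∈ Icc 1 ⌊Y⌋₊, |b k| * ellp Y k ^ m ≤ Real.log Y ^ m * L4 :=
    fun m ↦ sum_abs_copTauW_primeSq_ellp_pow_le n m hY
  have h1I : 1 ∈ Icc 1 ⌊Y⌋₊ := Finset.mem_Icc.2 ⟨le_rfl, Nat.le_floor (by simpa using hY)⟩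
  have hl1 : ellp Y 1 = Real.log Y := by rw [ellp_eq_log hY0.le h1I]; simp
  have hSbt : ∀ m : ℕ, ∑ k ∈ Icc 1 ⌊Y⌋₊, |b k - if k = 1 then c else 0| * ellp Y k ^ m ≤ Real.log Y ^ m * W := by
    intro m
    have hpt : ∀ k ∈ Icc 1 ⌊Y⌋₊, |b k - if k = 1 then c else 0| * ellp Y k ^ m ≤
        |b k| * ellp Y k ^ m + (if k = 1 then |c| * ellp Y k ^ m else 0) := by
      intro k _
      split_ifs with hk
      · have : |b k - c| ≤ |b k| + |c| := abs_sub _ _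
        have h0 : 0 ≤ ellp Y k ^ m := pow_nonneg (ellp_nonneg Y k) m
        nlinarith
      · rw [sub_zero]; linarith
    refine (Finset.sum_le_sum hpt).trans ?_
    rw [Finset.sum_add_distrib, Finset.sum_ite_eq' (Icc 1 ⌊Y⌋₊) 1, if_pos h1I, hl1]
    have := hSb m
    rw [hW]; nlinarith [pow_nonneg hLY m]
  have hSδ : ∑ k ∈ Icc 1 ⌊Y⌋₊, |(if k = 1 then (1 : ℝ) else 0)| * ellp Y k ^ i = Real.log Y ^ i := by
    rw [Finset.sum_eq_single_of_mem 1 h1I (fun k _ hk ↦ by simp [hk])]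
    simp [hl1]
  -- the `δ⊗δ` value
  have hRα : |(∫ u₁ in Set.Ioi (0 : ℝ), ∫ u₂ in Set.Ioi (α / u₁),
      Real.exp (-(u₁ + u₂)) / (1 - Real.exp (-(u₁ + u₂))) ^ 2) - (Real.log (1 / α) / 2 + E₀₀)| ≤
      C₀ * (sq + x ^ 6 / (1 + Real.log K₁) ^ 12) := by
    rcases Nat.eq_zero_or_pos K₁ with hK | hK
    · -- threshold `0`: no constraint on `α`; trivial bound by `C₀·x⁶`
      have hK' : (K₁ : ℝ) = 0 := by exact_mod_cast hK
      have hden : (1 + Real.log (K₁ : ℝ)) ^ 12 = 1 := by rw [hK', Real.log_zero]; norm_num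
      rw [hden, div_one]
      have hx6 : x ≤ x ^ 6 := le_self_pow₀ hx1 (by norm_num)
      rcases le_or_gt α 1 with hα1 | hα1
      · have h := hRs α hα hα1
        have : Real.sqrt α ≤ 1 := Real.sqrt_le_one.mpr hα1 |>.trans_eq' rfl
        calc _ ≤ C₀ * Real.sqrt α := h
          _ ≤ C₀ * 1 := mul_le_mul_of_nonneg_left (Real.sqrt_le_one.2 hα1) hC₀
          _ ≤ C₀ * (sq + x ^ 6) := by
              apply mul_le_mul_of_nonneg_left _ hC₀; nlinarith
      · have h := hRt α hα1.le
        have hlx : 1 + Real.log α ≤ x := by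
          rw [hx]
          have hlog : Real.log (2 * α * Y ^ 2) = Real.log 2 + Real.log α + 2 * Real.log Y := by
            rw [Real.log_mul (by positivity) (by positivity), Real.log_mul (by norm_num) hα.ne', Real.log_pow]
            push_cast; ring
          have hl2 : 0 < Real.log 2 := Real.log_pos (by norm_num)
          have : Real.log α ≤ |Real.log (2 * α * Y ^ 2)| := by
            rw [hlog]; exact le_trans (by linarith) (le_abs_self _)
          linarith
        calc _ ≤ C₀ * (1 + Real.log α) := h
          _ ≤ C₀ * x := mul_le_mul_of_nonneg_left hlx hC₀
          _ ≤ C₀ * (sq + x ^ 6) := by apply mul_le_mul_of_nonneg_left _ hC₀; linarith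
    · -- threshold `K₁ ≥ 1`: `α ≤ 2αK₁Y ≤ 1`, power saving
      have hK1 : (1 : ℝ) ≤ K₁ := by exact_mod_cast hK
      have hαle : α ≤ 2 * α * K₁ * Y := by
        have h2 : (1 : ℝ) ≤ 2 * K₁ * Y := by nlinarith
        have := mul_le_mul_of_nonneg_left h2 hα.le
        linarith
      have hα1 : α ≤ 1 := hαle.trans hY₁
      have h := hRs α hα hα1
      calc _ ≤ C₀ * Real.sqrt α := h
        _ ≤ C₀ * sq := mul_le_mul_of_nonneg_left (Real.sqrt_le_sqrt hαle) hC₀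
        _ ≤ C₀ * (sq + x ^ 6 / (1 + Real.log K₁) ^ 12) := by
            apply mul_le_mul_of_nonneg_left _ hC₀
            have : 0 ≤ x ^ 6 / (1 + Real.log K₁) ^ 12 := by positivity
            linarith
  -- bookkeeping
  have hLi : 0 ≤ Real.log Y ^ i := pow_nonneg hLY i
  have hLj : 0 ≤ Real.log Y ^ j := pow_nonneg hLY j
  have hc' : |c| ≤ C_P * D := hc
  have hcW : |c| ≤ W := hc'.trans (by rw [hW]; linarith)
  have hL4W : L4 ≤ W := by rw [hW]; nlinarith
  have hx6 : 0 ≤ x ^ 6 := by positivity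
  have hK12 : 0 < (1 + Real.log (K₁ : ℝ)) ^ 12 := by positivity
  -- each of the five terms against `log^{i+j}Y · C₀ · W² · (…)`
  have hP3 : 0 ≤ 3 * C₀ * sq := by positivity
  have hP9 : 0 ≤ 9 * C₀ * x ^ 6 := by positivity
  have hTW : T ≤ W / (1 + Real.log K₁) ^ 12 := by
    rw [hT]; apply div_le_div_of_nonneg_right _ hK12.le; rw [hW]; linarith [hL41]
  have hTW2 : 2 * T ≤ 2 * (W / (1 + Real.log K₁) ^ 12) := by linarith
  have t1 : (∑ k ∈ Icc 1 ⌊Y⌋₊, |b k - if k = 1 then c else 0| * ellp Y k ^ i) *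
      (L4 * (Real.log Y ^ j * (3 * C₀ * sq))) ≤ Real.log Y ^ (i + j) * (C₀ * W ^ 2 * (3 * sq)) := by
    have hX : 0 ≤ Real.log Y ^ j * (3 * C₀ * sq) := mul_nonneg hLj hP3
    calc _ ≤ (Real.log Y ^ i * W) * (W * (Real.log Y ^ j * (3 * C₀ * sq))) :=
          mul_le_mul (hSbt i) (mul_le_mul_of_nonneg_right hL4W hX) (mul_nonneg (by positivity) hX)
            (mul_nonneg hLi hW0)
      _ = _ := by rw [pow_add]; ring
  have t2 : (∑ k ∈ Icc 1 ⌊Y⌋₊, |b k| * ellp Y k ^ j) * ((2 * T) * (Real.log Y ^ i * (9 * C₀ * x ^ 6))) ≤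
      Real.log Y ^ (i + j) * (C₀ * W ^ 2 * (18 * x ^ 6 / (1 + Real.log K₁) ^ 12)) := by
    have hSbj : ∑ k ∈ Icc 1 ⌊Y⌋₊, |b k| * ellp Y k ^ j ≤ Real.log Y ^ j * W :=
      (hSb j).trans (mul_le_mul_of_nonneg_left hL4W hLj)
    have hX : 0 ≤ Real.log Y ^ i * (9 * C₀ * x ^ 6) := mul_nonneg hLi hP9
    calc _ ≤ (Real.log Y ^ j * W) * ((2 * T) * (Real.log Y ^ i * (9 * C₀ * x ^ 6))) :=
          mul_le_mul_of_nonneg_right hSbj (mul_nonneg (by positivity) hX)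
      _ ≤ (Real.log Y ^ j * W) * ((2 * (W / (1 + Real.log K₁) ^ 12)) * (Real.log Y ^ i * (9 * C₀ * x ^ 6))) :=
          mul_le_mul_of_nonneg_left (mul_le_mul_of_nonneg_right hTW2 hX) (mul_nonneg hLj hW0)
      _ = _ := by rw [pow_add]; field_simp; ring
  have t3 : |c| * ((∑ k ∈ Icc 1 ⌊Y⌋₊, |b k - if k = 1 then c else 0| * ellp Y k ^ j) *
      (1 * (Real.log Y ^ i * (3 * C₀ * sq)))) ≤ Real.log Y ^ (i + j) * (C₀ * W ^ 2 * (3 * sq)) := by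
    have hX : 0 ≤ 1 * (Real.log Y ^ i * (3 * C₀ * sq)) := by rw [one_mul]; exact mul_nonneg hLi hP3
    calc _ ≤ |c| * ((Real.log Y ^ j * W) * (1 * (Real.log Y ^ i * (3 * C₀ * sq)))) :=
          mul_le_mul_of_nonneg_left (mul_le_mul_of_nonneg_right (hSbt j) hX) (abs_nonneg c)
      _ ≤ W * ((Real.log Y ^ j * W) * (1 * (Real.log Y ^ i * (3 * C₀ * sq)))) :=
          mul_le_mul_of_nonneg_right hcW (mul_nonneg (mul_nonneg hLj hW0) hX)
      _ = _ := by rw [pow_add]; ring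
  have t4 : |c| * ((∑ k ∈ Icc 1 ⌊Y⌋₊, |(if k = 1 then (1 : ℝ) else 0)| * ellp Y k ^ i) *
      ((2 * T) * (Real.log Y ^ j * (9 * C₀ * x ^ 6)))) ≤
      Real.log Y ^ (i + j) * (C₀ * W ^ 2 * (18 * x ^ 6 / (1 + Real.log K₁) ^ 12)) := by
    rw [hSδ]
    have hX : 0 ≤ Real.log Y ^ j * (9 * C₀ * x ^ 6) := mul_nonneg hLj hP9
    calc _ ≤ W * (Real.log Y ^ i * ((2 * T) * (Real.log Y ^ j * (9 * C₀ * x ^ 6)))) :=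
          mul_le_mul_of_nonneg_right hcW (mul_nonneg hLi (mul_nonneg (by positivity) hX))
      _ ≤ W * (Real.log Y ^ i * ((2 * (W / (1 + Real.log K₁) ^ 12)) * (Real.log Y ^ j * (9 * C₀ * x ^ 6)))) :=
          mul_le_mul_of_nonneg_left (mul_le_mul_of_nonneg_left (mul_le_mul_of_nonneg_right hTW2 hX) hLi) hW0
      _ = _ := by rw [pow_add]; field_simp; ring
  have t5 : c ^ 2 * Real.log Y ^ i * Real.log Y ^ j *
      |(∫ u₁ in Set.Ioi (0 : ℝ), ∫ u₂ in Set.Ioi (α / u₁),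
        Real.exp (-(u₁ + u₂)) / (1 - Real.exp (-(u₁ + u₂))) ^ 2) - (Real.log (1 / α) / 2 + E₀₀)| ≤
      Real.log Y ^ (i + j) * (C₀ * W ^ 2 * (sq + x ^ 6 / (1 + Real.log K₁) ^ 12)) := by
    have hc2 : c ^ 2 ≤ W ^ 2 := by
      rw [← sq_abs]; exact pow_le_pow_left₀ (abs_nonneg c) hcW 2
    have hW2 : 0 ≤ W ^ 2 := pow_nonneg hW0 2
    calc _ ≤ W ^ 2 * Real.log Y ^ i * Real.log Y ^ j * (C₀ * (sq + x ^ 6 / (1 + Real.log K₁) ^ 12)) :=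
          mul_le_mul (mul_le_mul_of_nonneg_right (mul_le_mul_of_nonneg_right hc2 hLi) hLj) hRα (abs_nonneg _)
            (mul_nonneg (mul_nonneg hW2 hLi) hLj)
      _ = _ := by rw [pow_add]; ring
  rw [hl1]
  have hsum := add_le_add (add_le_add (add_le_add t1 t2) (add_le_add t3 t4)) t5
  refine le_trans (le_of_eq ?_) (hsum.trans (le_of_eq ?_))
  · ring
  · field_simp; ring

end Summit.Parity.GeneralizedHardyLittlewood.Theorems.MomentsBeyondDiagonal.DiagCorner

end
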